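import Mathlib
import HarnessLib
import Literature.MathematicalPhysics.QuantumFieldTheory.ConstructiveQFTWave0
import Summits.Ventures.LatticeQCDFlow.Scaling.Conjectures
import Summits.Ventures.LatticeQCDFlow.Scaling.StaircaseExtensiveAction
import Summits.Ventures.LatticeQCDFlow.Scaling.ExactTransportVolume
import Summits.Ventures.LatticeQCDFlow.Scaling.ExactTransportSteps

/-!
# LatticeQCDFlow / Scaling — (C2a) split into its ONE-SIDED laws: exact transport must EXPAND by `e^{cβ}` and CONTRACT by `β^{c′}`

HONEST FRAMING: exact (Metropolis-corrected) sampling algorithms for lattice gauge theory; figures of merit are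
autocorrelation/cost numbers at stated couplings and volumes; no continuum-physics claim.

Venture `LatticeQCDFlow` (cell pub-lqcd), topic `Scaling`, FANOUT row 29 (theory-2) — OUR WORK (THEORY-2.md §3.3,
v2.6 "one-sided transport laws"; file 2 of 3).  Row 30's theorem `exactTransportBiLipschitz_of_ballVolumes`
(`Scaling/ExactTransportVolume.lean`) bounds the PRODUCT `Lip(T)·coLip(T) ≥ e^{cβ}` of an exact transport
`T_*Haar^{⊗E} = μ_{Λ,β}`.  Here the two sides are separated, which is what the comparison with the rigorous
flow-built Lipschitz transport maps of the `φ⁴` literature (Bauerschmidt–Bodineau–Dagallier, Shenfeld: a map from a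
Gaussian reference that is Lipschitz UNIFORMLY in the volume away from criticality) requires:

* `ExactTransportExpansion` / `exactTransportExpansion_of_ballVolumes` — the EXPANSION LAW: for every compact metric
  group `G` with two-sided small-ball Haar volumes `a·r^κ ≤ Haar(B̄(g,r)) ≤ A·r^κ` (`κ ≥ 1`), every continuous `ρ`
  with `-N ≤ Re tr ρ ≤ N` and a NON-CONSTANT character, `d ≥ 2`: there are `c > 0`, `β₀` with `Lip(T) ≥ e^{cβ}` for
  every exact transport `T` that is merely LIPSCHITZ, every `L ≥ 2`, every `β ≥ β₀` — uniformly in the volume.  No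
  co-Lipschitz hypothesis.  Mechanism: `μ_β` charges the configurations of action `> s₀L^d/2` (it charges every open
  set), a `K`-Lipschitz exact `T` covers a ball about such a point `y = Tx` by the image of `B̄(x, r/K)`, so
  `(a(r/K)^κ)^{#E} ≤ μ_β(B̄(y,r)) ≤ Z⁻¹e^{-β(S(y)-ε)}(Ar^κ)^{#E}` (row 30's STEP 1, isolated below as
  `log_partitionFunction_add_le`), while `Z ≥ e^{-βs₀L^d/4}·(a r₀^κ)^{#E}` from the sup-ball of radius `r₀(ρ,d,s₀)`
  about the identity configuration on which EVERY plaquette costs `≤ s₀/(4·#planes+4)` (`exists_radius_action_le`, a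
  continuity statement on `G⁴`, uniform in `L`).  Hence `κ·d·log K ≥ β·s₀/4 - d·C₁`: `c = s₀/(8κd)`.  This side is an
  EXACTNESS ARTEFACT (it is driven by the `e^{-Θ(βL^d)}`-rare high-action configurations) and is the side that the
  `φ⁴` maps control from a Gaussian (tailed) reference; from the compact Haar prior no volume-uniform AND `β`-uniform
  Lipschitz exact transport exists.
* `ExactTransportContraction` / `exactTransportContraction_of_laplaceHalfMass` — the CONTRACTION LAW: under the same
  ball-volume hypothesis and the tree's Laplace half-mass law `Conjectures.LaplaceHalfMass d N G ρ nTr` (PROVED for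
  `U(1)`, `U(N)`, `SU(N)` in `Scaling/LatticeLaplaceHalfMassInstances.lean`) with `nTr(L) ≥ q·L^d` for `L ≥ L₀`:
  there are `c > 0`, `C`, `β₀` with `log coLip(T) ≥ c·log β - C` for every exact transport that is merely
  CO-LIPSCHITZ (`AntilipschitzWith K' T`; measurability is not assumed — it follows from exactness), every `L ≥ L₀`,
  `β ≥ β₀`: `c = q/(2κd)`.  Mechanism: half of `μ_β` sits on a set of prior mass `≤ (c₀/β)^{nTr/2}`, so
  `Z ≤ 2(c₀/β)^{nTr/2}` (`e^{-βS} ≤ 1`), while row 30's STEP 2 (`neg_log_partitionFunction_sub_le`) at a point of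
  action `< 1/β` gives `-log Z ≤ 1 + #E·(log(A/a) + κ log K')`.  This is the ENTROPY side: polynomial in `β` per link
  (extensive only as a log-Jacobian, THEORY-2 (Gβ)/T2-O″), and it is the side that survives `ε`-accuracy.
* Instances with NO hypothesis left are file 3, `Scaling/ExactTransportOneSidedInstances.lean`:
  `U1.exactTransportExpansion` (`d ≥ 2`), `UN.exactTransportExpansion` (`N ≥ 1`, `d ≥ 2`, Hilbert–Schmidt metric),
  `SUN.exactTransportExpansion` (`N ≥ 2`, `d ≥ 2`); `U1/UN/SUN.exactTransportContraction` (same ranges, `L ≥ 4`,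
  `c = 1/(16d)`).  The items themselves and the isolated STEP 1 / STEP 2 are file 1, `Scaling/ExactTransportSteps.lean`.

So the exponential-in-`β` content of (C2a) is ENTIRELY on the expansion side; the contraction forced by weak-coupling
concentration is `β^{Θ(1)}` per link.  Elementary given the tree; nothing here is cited as a fact.
-/

noncomputable section

namespace Summit.Ventures.LatticeQCDFlow.Theory2.Lattice

open MeasureTheory Metric Set Literature.MathematicalPhysics.QuantumFieldTheory

/-! ## §2. The expansion law -/

section Expansion

variable {N : ℕ} {G : Type} [Group G] [MetricSpace G] [IsTopologicalGroup G] [CompactSpace G]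
  [SecondCountableTopology G] [MeasurableSpace G] [BorelSpace G]
  (ρ : G →* Matrix (Fin N) (Fin N) ℂ)

/-- **(C2a-E) THE EXPANSION LAW, PROVED** (OURS): two-sided ball volumes with exponent `κ ≥ 1`, a continuous `ρ`
with `-N ≤ Re tr ρ ≤ N` and a non-constant character, `d ≥ 2` ⟹ `ExactTransportExpansion d N G ρ` with
`c = s₀/(8κd)`, `s₀ = (N - Re tr ρ(g))/2` the staircase constant of `extensive_action_of_nonconstant`, and
`β₀ = 8d·C₁/s₀`, `C₁ = log(A/a) + log(1/a) + κ·log(1/r₀)`.  See the module docstring for the mechanism. [folklore] -/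
theorem exactTransportExpansion_of_ballVolumes (d : ℕ) (hd : 2 ≤ d)
    (hρ : Continuous (ρ : G → Matrix (Fin N) (Fin N) ℂ))
    (htr : ∀ g, (ρ g).trace.re ≤ N) (htr' : ∀ g, -(N : ℝ) ≤ (ρ g).trace.re)
    (hnc : ∃ g : G, (ρ g).trace.re ≠ N)
    {κ : ℕ} (hκ : 0 < κ) {a A : ℝ} (ha : 0 < a)
    (hlo : ∀ (g : G) (r : ℝ), 0 < r → r ≤ 1 → a * r ^ κ ≤ (haarProbability G (closedBall g r)).toReal)
    (hup : ∀ (g : G) (r : ℝ), 0 < r → (haarProbability G (closedBall g r)).toReal ≤ A * r ^ κ) :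
    ExactTransportExpansion d N G ρ := by
  obtain ⟨s₀, hs₀, hconf⟩ := extensive_action_of_nonconstant (d := d) ρ htr hnc hd
  have haA : a ≤ A := by
    have h1 := hlo 1 1 one_pos le_rfl
    have h2 := hup 1 1 one_pos
    rw [one_pow, mul_one] at h1 h2
    exact h1.trans h2
  have hA : 0 < A := ha.trans_le haA
  have hlogAa : 0 ≤ Real.log (A / a) := Real.log_nonneg ((one_le_div ha).2 haA)
  have ha1 : a ≤ 1 := by
    have h1 := hlo 1 1 one_pos le_rfl
    rw [one_pow, mul_one] at h1
    exact h1.trans (ENNReal.toReal_mono ENNReal.one_ne_top prob_le_one)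
  have hloga : Real.log a ≤ 0 := Real.log_nonpos ha.le ha1
  -- the uniform low-action radius
  set m : ℕ := Fintype.card {p : Fin d × Fin d // p.1 < p.2} with hm
  set η : ℝ := s₀ / (4 * ((m : ℝ) + 1)) with hηdef
  have hη : 0 < η := by positivity
  obtain ⟨r₀, hr₀, hr₀1, hball⟩ := exists_radius_action_le ρ hρ hη
  have hlogr₀ : Real.log r₀ ≤ 0 := Real.log_nonpos hr₀.le hr₀1
  set C₁ : ℝ := Real.log (A / a) - Real.log a - κ * Real.log r₀ with hC₁
  have hκr : (0 : ℝ) < κ := by exact_mod_cast hκ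
  have hC₁0 : 0 ≤ C₁ := by
    have : κ * Real.log r₀ ≤ 0 := mul_nonpos_of_nonneg_of_nonpos hκr.le hlogr₀
    linarith
  have hdr : (2 : ℝ) ≤ d := by exact_mod_cast hd
  refine ⟨s₀ / (8 * κ * d), by positivity, 8 * d * C₁ / s₀, fun L _ hL β hβ T K hT hmap => ?_⟩
  have hβ0 : 0 ≤ β := le_trans (by positivity) hβ
  have hL1 : (1 : ℝ) ≤ L := by exact_mod_cast (NeZero.one_le : 1 ≤ L)
  have hLd0 : (0 : ℝ) < (L : ℝ) ^ d := by positivity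
  set S : GaugeConfig d L G → ℝ := wilsonAction (d := d) (L := L) ρ with hSdef
  have hScont : Continuous S := continuous_wilsonAction (d := d) (L := L) ρ hρ
  -- cardinalities
  have hEn : Fintype.card (Edge d L) = L ^ d * d := by simp [Fintype.card_prod, ZMod.card, Fintype.card_fin]
  have hE : (Fintype.card (Edge d L) : ℝ) = d * (L : ℝ) ^ d := by rw [hEn]; push_cast; ring
  have hPn : Fintype.card (Plaquette d L) = L ^ d * m := by
    rw [hm]; simp [Fintype.card_prod, ZMod.card, Fintype.card_fin]
  have hP : (Fintype.card (Plaquette d L) : ℝ) = (L : ℝ) ^ d * m := by rw [hPn]; push_cast; ring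
  -- the partition function
  have hZ0 : partitionFunction (d := d) (L := L) ρ β ≠ 0 := partitionFunction_ne_zero ρ hρ β
  have hZtop : partitionFunction (d := d) (L := L) ρ β ≠ ⊤ :=
    ne_top_of_le_ne_top ENNReal.one_ne_top (partitionFunction_le_one ρ htr hβ0)
  set Z : ℝ := (partitionFunction (d := d) (L := L) ρ β).toReal with hZdef
  have hZpos : 0 < Z := ENNReal.toReal_pos hZ0 hZtop
  -- low action on `B̄(1, r₀)`
  have hlow : ∀ U : GaugeConfig d L G, dist U 1 ≤ r₀ → S U ≤ s₀ * (L : ℝ) ^ d / 4 := by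
    intro U hU
    have h := hball d L U hU
    rw [hP] at h
    calc S U ≤ η * ((L : ℝ) ^ d * m) := h
      _ ≤ η * ((L : ℝ) ^ d * (m + 1)) := by gcongr; linarith
      _ = s₀ * (L : ℝ) ^ d / 4 := by rw [hηdef]; field_simp
  -- `Z ≥ e^{-βs₀L^d/4}·(a r₀^κ)^{#E}`
  have hZlo : Real.exp (-(β * (s₀ * (L : ℝ) ^ d / 4))) * (a * r₀ ^ κ) ^ Fintype.card (Edge d L) ≤ Z := by
    have h1 := le_partitionFunction_of_ball ρ hβ0 hlow
    have h2 := pow_le_pi_closedBall ha.le hlo (1 : GaugeConfig d L G) hr₀ hr₀1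
    have h3 := ENNReal.toReal_mono hZtop h1
    rw [ENNReal.toReal_mul, ENNReal.toReal_ofReal (Real.exp_pos _).le] at h3
    exact le_trans (mul_le_mul_of_nonneg_left h2 (Real.exp_pos _).le) h3
  have hlogZ : -(β * (s₀ * (L : ℝ) ^ d / 4)) + Fintype.card (Edge d L) * (Real.log a + κ * Real.log r₀) ≤
      Real.log Z := by
    have h := Real.log_le_log (by positivity) hZlo
    rwa [Real.log_mul (Real.exp_pos _).ne' (by positivity), Real.log_exp, Real.log_pow,
      Real.log_mul ha.ne' (by positivity), Real.log_pow] at h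
  -- a high-action point and a low-action point in the image of `T`; `K > 0`
  obtain ⟨Vhi, hVhi⟩ := hconf L hL
  have hs₀L : 0 < s₀ * (L : ℝ) ^ d := by positivity
  obtain ⟨x₁, hx₁⟩ := exists_apply_mem_of_map_eq ρ hρ htr htr' hβ0 hmap
    (isOpen_lt continuous_const hScont : IsOpen {U | s₀ * (L : ℝ) ^ d / 2 < S U})
    ⟨Vhi, by show s₀ * (L : ℝ) ^ d / 2 < S Vhi; rw [hSdef]; linarith⟩
  obtain ⟨x₀, hx₀⟩ := exists_apply_mem_of_map_eq ρ hρ htr htr' hβ0 hmap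
    (isOpen_lt hScont continuous_const : IsOpen {U | S U < s₀ * (L : ℝ) ^ d / 2})
    ⟨1, by
      show S 1 < s₀ * (L : ℝ) ^ d / 2
      have := hlow 1 (by rw [dist_self]; exact hr₀.le)
      linarith⟩
  have hx₁' : s₀ * (L : ℝ) ^ d / 2 < S (T x₁) := hx₁
  have hx₀' : S (T x₀) < s₀ * (L : ℝ) ^ d / 2 := hx₀
  have hK0 : 0 < (K : ℝ) := by
    have hne : T x₁ ≠ T x₀ := fun h => by rw [h] at hx₁'; linarith
    have h1 := hT.dist_le_mul x₁ x₀
    have hpos : 0 < dist (T x₁) (T x₀) := dist_pos.2 hne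
    rcases K.coe_nonneg.eq_or_lt with h | h
    · rw [← h, zero_mul] at h1; linarith
    · exact h
  -- STEP 1 at `x₁`, and combine
  have h1 := log_partitionFunction_add_le ρ hρ htr ha hA hlo hup hβ0 hK0 hT hmap x₁
  rw [hE] at h1 hlogZ
  have hmain : β * (s₀ * (L : ℝ) ^ d / 4) ≤ d * (L : ℝ) ^ d * (C₁ + κ * Real.log K) := by
    have hprod : β * (s₀ * (L : ℝ) ^ d / 2) ≤ β * S (T x₁) := mul_le_mul_of_nonneg_left hx₁'.le hβ0
    rw [hC₁]
    linarith [h1, hlogZ, hprod]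
  have hmain' : β * s₀ / 4 ≤ d * (C₁ + κ * Real.log K) := by
    refine le_of_not_gt fun hcon => ?_
    have := mul_lt_mul_of_pos_left hcon hLd0
    linarith
  have hβ' : 8 * d * C₁ ≤ β * s₀ := by
    have := mul_le_mul_of_nonneg_right hβ hs₀.le
    rwa [div_mul_cancel₀ _ hs₀.ne'] at this
  have hdk : (0 : ℝ) < 8 * κ * d := by positivity
  have key : s₀ / (8 * κ * d) * β ≤ Real.log K := by
    rw [div_mul_eq_mul_div, div_le_iff₀ hdk]
    linarith [hmain', hβ']
  calc Real.exp (s₀ / (8 * κ * d) * β) ≤ Real.exp (Real.log K) := Real.exp_le_exp.2 key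
    _ = K := Real.exp_log hK0

end Expansion

/-! ## §3. The contraction law -/

section Contraction

variable {N : ℕ} {G : Type} [Group G] [MetricSpace G] [IsTopologicalGroup G] [CompactSpace G]
  [SecondCountableTopology G] [MeasurableSpace G] [BorelSpace G]
  (ρ : G →* Matrix (Fin N) (Fin N) ℂ)

/-- **(C2a-C) THE CONTRACTION LAW, PROVED from the Laplace half-mass law** (OURS): two-sided ball volumes with
exponent `κ ≥ 1`, a continuous `ρ` with `-N ≤ Re tr ρ ≤ N`, `d ≥ 1`, the tree item `Conjectures.LaplaceHalfMass d N G
ρ nTr` and `nTr(L) ≥ q·L^d` (`q > 0`) for `L ≥ L₀` ⟹ `ExactTransportContraction d N G ρ` with `c = q/(2κd)`.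
[folklore] -/
theorem exactTransportContraction_of_laplaceHalfMass (d : ℕ) (hd : 1 ≤ d)
    (hρ : Continuous (ρ : G → Matrix (Fin N) (Fin N) ℂ))
    (htr : ∀ g, (ρ g).trace.re ≤ N) (htr' : ∀ g, -(N : ℝ) ≤ (ρ g).trace.re)
    {κ : ℕ} (hκ : 0 < κ) {a A : ℝ} (ha : 0 < a)
    (hlo : ∀ (g : G) (r : ℝ), 0 < r → r ≤ 1 → a * r ^ κ ≤ (haarProbability G (closedBall g r)).toReal)
    (hup : ∀ (g : G) (r : ℝ), 0 < r → (haarProbability G (closedBall g r)).toReal ≤ A * r ^ κ)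
    {nTr : ℕ → ℝ} (hLHM : Conjectures.LaplaceHalfMass d N G ρ nTr)
    {q : ℝ} (hq : 0 < q) {L₀ : ℕ} (hnTr : ∀ L : ℕ, L₀ ≤ L → q * (L : ℝ) ^ d ≤ nTr L) :
    ExactTransportContraction d N G ρ := by
  obtain ⟨c₀, hc₀, β₁, hβ₁, hL⟩ := hLHM
  have haA : a ≤ A := by
    have h1 := hlo 1 1 one_pos le_rfl
    have h2 := hup 1 1 one_pos
    rw [one_pow, mul_one] at h1 h2
    exact h1.trans h2
  have hA : 0 < A := ha.trans_le haA
  have hlogAa : 0 ≤ Real.log (A / a) := Real.log_nonneg ((one_le_div ha).2 haA)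
  have hκr : (0 : ℝ) < κ := by exact_mod_cast hκ
  have hdr : (1 : ℝ) ≤ d := by exact_mod_cast hd
  have hkd : (0 : ℝ) < κ * d := by positivity
  -- a non-trivial element of `G` (from the upper ball volume), for `K' > 0`
  obtain ⟨g₁, hg₁⟩ := exists_ne_one_of_ballVolumes hκ hA hup
  refine ⟨q / (2 * κ * d), by positivity,
    (q / 2 * Real.log c₀ + (Real.log 2 + 1) + d * Real.log (A / a)) / (κ * d), max β₁ c₀, L₀,
    fun L _ hLL β hβ T K' hT' hmap => ?_⟩
  have hββ₁ : β₁ ≤ β := le_trans (le_max_left _ _) hβ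
  have hβc₀ : c₀ ≤ β := le_trans (le_max_right _ _) hβ
  have hβpos : 0 < β := lt_of_lt_of_le hβ₁ hββ₁
  have hβ0 : 0 ≤ β := hβpos.le
  have hL1 : (1 : ℝ) ≤ L := by exact_mod_cast (NeZero.one_le : 1 ≤ L)
  have hLd0 : (0 : ℝ) < (L : ℝ) ^ d := by positivity
  have hLd1 : (1 : ℝ) ≤ (L : ℝ) ^ d := one_le_pow₀ hL1
  set π : Measure (GaugeConfig d L G) := Measure.pi fun _ : Edge d L => haarProbability G with hπ
  set S : GaugeConfig d L G → ℝ := wilsonAction (d := d) (L := L) ρ with hSdef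
  have hScont : Continuous S := continuous_wilsonAction (d := d) (L := L) ρ hρ
  have hEn : Fintype.card (Edge d L) = L ^ d * d := by simp [Fintype.card_prod, ZMod.card, Fintype.card_fin]
  have hE : (Fintype.card (Edge d L) : ℝ) = d * (L : ℝ) ^ d := by rw [hEn]; push_cast; ring
  have hZ0 : partitionFunction (d := d) (L := L) ρ β ≠ 0 := partitionFunction_ne_zero ρ hρ β
  have hZtop : partitionFunction (d := d) (L := L) ρ β ≠ ⊤ :=
    ne_top_of_le_ne_top ENNReal.one_ne_top (partitionFunction_le_one ρ htr hβ0)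
  set Z : ℝ := (partitionFunction (d := d) (L := L) ρ β).toReal with hZdef
  have hZpos : 0 < Z := ENNReal.toReal_pos hZ0 hZtop
  have hμW : ∀ B : Set (GaugeConfig d L G),
      wilsonMeasure (d := d) (L := L) ρ β B = (partitionFunction ρ β)⁻¹ * wilsonWeight ρ β B := fun B => by
    show ((partitionFunction ρ β)⁻¹ • wilsonWeight ρ β) B = _
    rw [Measure.smul_apply, smul_eq_mul]
  -- `K' > 0`: two distinct configurations
  have hK'0 : 0 < (K' : ℝ) := by
    set e₀ : Edge d L := (fun _ => 0, ⟨0, hd⟩) with he₀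
    have hne : (fun _ : Edge d L => g₁) ≠ (1 : GaugeConfig d L G) := fun h => hg₁ (by
      have := congr_fun h e₀
      simpa using this)
    have h1 := hT'.le_mul_dist (fun _ : Edge d L => g₁) 1
    have hpos : 0 < dist (fun _ : Edge d L => g₁) (1 : GaugeConfig d L G) := dist_pos.2 hne
    rcases K'.coe_nonneg.eq_or_lt with h | h
    · rw [← h, zero_mul] at h1; linarith
    · exact h
  -- `Z ≤ 2·(c₀/β)^{nTr/2}` from the half-mass set
  obtain ⟨E, hEm, hμE, hπE⟩ := hL L β hββ₁
  have hW : wilsonWeight (d := d) (L := L) ρ β E ≤ π E := by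
    have h := wilsonWeight_le_of_le ρ hβ0 hEm (s₁ := 0) fun U _ => wilsonAction_nonneg ρ htr U
    simpa using h
  have hrpow : 0 ≤ (c₀ / β) ^ (nTr L / 2) := Real.rpow_nonneg (by positivity) _
  have hWE : (wilsonWeight (d := d) (L := L) ρ β E).toReal ≤ (c₀ / β) ^ (nTr L / 2) := by
    have h := ENNReal.toReal_mono ENNReal.ofReal_ne_top (hW.trans hπE)
    rwa [ENNReal.toReal_ofReal hrpow] at h
  have hZle : Z ≤ 2 * (c₀ / β) ^ (nTr L / 2) := by
    have hfin : (partitionFunction (d := d) (L := L) ρ β)⁻¹ * wilsonWeight ρ β E ≠ ⊤ :=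
      ENNReal.mul_ne_top (ENNReal.inv_ne_top.2 hZ0) (ne_top_of_le_ne_top (measure_ne_top π E) hW)
    have h := ENNReal.toReal_mono hfin (hμE.trans_eq (hμW E))
    rw [ENNReal.toReal_inv, ENNReal.toReal_mul, ENNReal.toReal_inv] at h
    have h2 : (2 : ℝ)⁻¹ ≤ Z⁻¹ * (wilsonWeight (d := d) (L := L) ρ β E).toReal := by simpa using h
    rw [inv_mul_eq_div, le_div_iff₀ hZpos] at h2
    linarith [h2, hWE]
  have hlogZ : Real.log Z ≤ Real.log 2 + nTr L / 2 * (Real.log c₀ - Real.log β) := by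
    have hpos2 : 0 < 2 * (c₀ / β) ^ (nTr L / 2) := by positivity
    have h := Real.log_le_log hZpos hZle
    rwa [Real.log_mul two_ne_zero (Real.rpow_pos_of_pos (by positivity) _).ne',
      Real.log_rpow (by positivity), Real.log_div hc₀.ne' hβpos.ne'] at h
  -- a point of the image with action `< 1/β`
  obtain ⟨x₂, hx₂⟩ := exists_apply_mem_of_map_eq ρ hρ htr htr' hβ0 hmap
    (isOpen_lt hScont continuous_const : IsOpen {U | S U < 1 / β})
    ⟨1, by show S 1 < 1 / β; rw [hSdef, wilsonAction_one]; positivity⟩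
  have hx₂' : S (T x₂) < 1 / β := hx₂
  have hβS : β * S (T x₂) ≤ 1 := by
    have := mul_lt_mul_of_pos_left hx₂' hβpos
    rw [mul_one_div_cancel hβpos.ne'] at this
    exact this.le
  -- STEP 2 at `x₂`, and combine
  have h2 := neg_log_partitionFunction_sub_le ρ hρ htr ha hA hlo hup hβ0 hK'0 hT' hmap x₂
  rw [hE] at h2
  have hlogβ : 0 ≤ Real.log β - Real.log c₀ := by
    rw [sub_nonneg]; exact Real.log_le_log hc₀ hβc₀
  have hq' : q * (L : ℝ) ^ d / 2 * (Real.log β - Real.log c₀) ≤ nTr L / 2 * (Real.log β - Real.log c₀) :=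
    mul_le_mul_of_nonneg_right (by linarith [hnTr L hLL]) hlogβ
  have hlog2 : 0 < Real.log 2 := Real.log_pos one_lt_two
  have hmain : (L : ℝ) ^ d * (q / 2 * (Real.log β - Real.log c₀) - (Real.log 2 + 1) - d * Real.log (A / a) -
      κ * d * Real.log K') ≤ 0 := by
    have hl : (Real.log 2 + 1) * 1 ≤ (Real.log 2 + 1) * (L : ℝ) ^ d :=
      mul_le_mul_of_nonneg_left hLd1 (by linarith)
    linarith [h2, hlogZ, hβS, hq', hl]
  have hmain' : q / 2 * (Real.log β - Real.log c₀) - (Real.log 2 + 1) - d * Real.log (A / a) ≤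
      κ * d * Real.log K' := by
    refine le_of_not_gt fun hcon => ?_
    have : 0 < (L : ℝ) ^ d * (q / 2 * (Real.log β - Real.log c₀) - (Real.log 2 + 1) - d * Real.log (A / a) -
        κ * d * Real.log K') := mul_pos hLd0 (by linarith)
    linarith
  rw [show q / (2 * κ * d) * Real.log β - (q / 2 * Real.log c₀ + (Real.log 2 + 1) + d * Real.log (A / a)) / (κ * d)
      = (q / 2 * (Real.log β - Real.log c₀) - (Real.log 2 + 1) - d * Real.log (A / a)) / (κ * d) by
    field_simp; ring, div_le_iff₀ hkd]
  linarith

end Contraction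

end Summit.Ventures.LatticeQCDFlow.Theory2.Lattice

end
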